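import Summits.Ventures.CertifiedManyBodySolver.Rows.CARPolyWindowSyntax
import HarnessLib

/-!
# The TWO-LEVEL (symmetry-adapted) Gram constructor for the kernel form of window-certificate soundness:
# `gramTB K blocks = Σ_blocks Σ_{i,j} 4^{−K} (rᵢ · rⱼ) · vᵢ† vⱼ`, PSD BY CONSTRUCTION (`S = R Rᵀ`), semantics `gramForm`

HONEST FRAMING: Lean plumbing towards «tier P» (an SDP window certificate becoming a kernel theorem), requested by the sizing
replay of the D-0150 box's CORE program (HOME/STATUS «LA214-TIERP-UPRIME U1»): in the SOS-FACTOR Gram shape `gramT K Q` of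
`Rows/CARPolyWindowSyntax.lean` a symmetry-adapted certificate must expand every factor column over RAW words (≈ 3·10⁹ word products
at CORE size), whereas the ADAPTED TWO-LEVEL shape below multiplies each pair of basis POLYNOMIALS of a block once and weights it by
the integer Gram entry `(R Rᵀ)ᵢⱼ` (≈ 3·10⁷ word products at CORE size) — the same certificate, two orders of magnitude fewer kernel
steps. Nothing of record moves; no claim node is discharged by this file; CONTROL/CALIBRATION context (wording (xx1)); no summit
statement is proved here. Seat hubbard-obs-p2 (STIFFNESS), `prover-hubbard-obs-p2-g22-0`, zero compute.

THE OBJECTS. A BLOCK is a list of pairs `(rᵢ, vᵢ)` — an integer factor row `rᵢ : List ℤ` (shorter rows are zero-padded) and a basis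
polynomial `vᵢ : Terms α` (a symmetry-adapted basis vector written over raw ladder words); `gramTB1 K RV` is the term list
`Σ_{i,j} ((rᵢ · rⱼ) / 4^K) · (vᵢ)† * vⱼ` and `gramTB K blocks` concatenates the blocks. SEMANTICS (`termOp_gramTB_eq_gramForm`): with the
index type `TBIdx blocks = Σ_b Fin |block b|`, operators `gramTBOp d blocks ⟨b, i⟩ = termOp d v_{b,i}` and the block-diagonal
coefficient matrix `gramTBCoef K blocks ⟨b,i⟩ ⟨b',j⟩ = [b = b'] (r_{b,i} · r_{b',j}) / 4^K`, the list denotes EXACTLY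
`gramForm (gramTBCoef K blocks) (gramTBOp d blocks)` (the tree's `StateRelaxationDuality.gramForm`); and `gramTBCoef K blocks` is
POSITIVE SEMIDEFINITE for every input (`gramTBCoef_posSemidef`: it is `F Fᴴ` for the zero-padded factor matrix
`F ⟨b,i⟩ (b',k) = [b = b'] r_{b,i}[k] / 2^K`, `Matrix.posSemidef_self_mul_conjTranspose`) — so a kernel replay never tests
positivity. The kernel theorem with an abstract Gram slot that consumes this is `Rows/CorrWindowCertKernelFormGram.lean`.

References: X. Han, arXiv:2006.06002 §2 eq. (2), §3 (Gram/positivity family of a bootstrap certificate) [Han2020Bootstrap];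
J. Wang et al., PRX 14 (2024) 031006 §III (symmetry-adapted blocks) [WangEtAl2024]; C. Jansson, D. Chaykin, C. Keil, SIAM J. Numer.
Anal. 46 (2008) 180 (rigorous certificates from floating-point SDP output: integer/dyadic rounding of the factor) [JanssonChaykinKeil2008].
-/

noncomputable section

namespace Summit.Ventures.CertifiedManyBodySolver

namespace CARPolyWindow

open Summit.Ventures.CertifiedQuantumChemistry Summit.Ventures.CertifiedQuantumChemistry.CARPoly
open Literature.MathematicalPhysics.QuantumManyBody.StateRelaxation
open Matrix
open scoped ComplexOrder BigOperators

/-! ## Syntax -/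

section Syntax

variable {α : Type*}

/-- Integer dot product of two coefficient rows, the shorter row zero-padded. [folklore] -/
def idot : List ℤ → List ℤ → ℤ
  | [], _ => 0
  | _ :: _, [] => 0
  | a :: r, b :: s => a * b + idot r s

/-- ONE two-level Gram block: `Σ_{i,j} ((rᵢ · rⱼ) / 4^K) · vᵢ† vⱼ` over the pairs `(rᵢ, vᵢ)` of the block.
[cite: Han2020Bootstrap, §2 eq. (2)] [cite: WangEtAl2024, §III] -/
def gramTB1 (K : ℕ) (RV : List (List ℤ × Terms α)) : Terms α :=
  RV.flatMap fun a => RV.flatMap fun b => scaleT ((idot a.1 b.1 : ℚ) / 4 ^ K) (mulT (daggerT a.2) b.2)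

/-- **The two-level Gram list**: the concatenation of the blocks. [cite: WangEtAl2024, §III] -/
def gramTB (K : ℕ) (blocks : List (List (List ℤ × Terms α))) : Terms α := blocks.flatMap (gramTB1 K)

/-- The index type of a block list: a block and a row of it. [folklore] -/
abbrev TBIdx (blocks : List (List (List ℤ × Terms α))) : Type := (b : Fin blocks.length) × Fin (blocks.get b).length

/-- The factor row at an index. [folklore] -/
def tbRow (blocks : List (List (List ℤ × Terms α))) (x : TBIdx blocks) : List ℤ := ((blocks.get x.1).get x.2).1

/-- The basis polynomial at an index. [folklore] -/
def tbPoly (blocks : List (List (List ℤ × Terms α))) (x : TBIdx blocks) : Terms α := ((blocks.get x.1).get x.2).2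

/-- A column bound: the total length of all factor rows (every row is at most this long). [folklore] -/
def tbCols (blocks : List (List (List ℤ × Terms α))) : ℕ :=
  ((blocks.flatMap id).map fun a => a.1.length).sum

/-- **The coefficient matrix** `Λ ⟨b,i⟩ ⟨b',j⟩ = [b = b'] · (r_{b,i} · r_{b',j}) / 4^K` (block-diagonal, `= F Fᴴ`).
[cite: JanssonChaykinKeil2008, §3] -/
def gramTBCoef (K : ℕ) (blocks : List (List (List ℤ × Terms α))) : Matrix (TBIdx blocks) (TBIdx blocks) ℂ :=
  fun x y => if x.1 = y.1 then ((((idot (tbRow blocks x) (tbRow blocks y) : ℚ) / 4 ^ K : ℚ)) : ℂ) else 0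

/-- **The zero-padded factor matrix** `F ⟨b,i⟩ (b',k) = [b = b'] · r_{b,i}[k] / 2^K`. [cite: JanssonChaykinKeil2008, §3] -/
def gramTBFactor (K : ℕ) (blocks : List (List (List ℤ × Terms α))) :
    Matrix (TBIdx blocks) (Fin blocks.length × Fin (tbCols blocks)) ℂ :=
  fun x c => if x.1 = c.1 then (((((tbRow blocks x).getD c.2 0 : ℤ) : ℚ) / 2 ^ K : ℚ) : ℂ) else 0

end Syntax

/-! ## The integer dot product as a padded sum -/

/-- `r · s = Σ_{k < C} r[k] s[k]` (zero-padded) whenever both rows have length `≤ C`. [folklore] -/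
theorem idot_eq_sum_getD : ∀ (r s : List ℤ) (C : ℕ), r.length ≤ C → s.length ≤ C →
    idot r s = ∑ k : Fin C, r.getD k 0 * s.getD k 0
  | [], s, C, _, _ => by simp [idot]
  | a :: r, [], C, _, _ => by simp [idot]
  | a :: r, b :: s, 0, hr, _ => by simp at hr
  | a :: r, b :: s, C + 1, hr, hs => by
    rw [idot, Fin.sum_univ_succ]
    simp only [Fin.val_zero, List.getD_cons_zero, Fin.val_succ, List.getD_cons_succ]
    rw [idot_eq_sum_getD r s C (by simpa using hr) (by simpa using hs)]

/-! ## Semantics -/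

section Semantics

variable {α : Type*} {ι : Type*} [LinearOrder ι] [Fintype ι]

/-- One block denotes `Σ_{i,j} ((rᵢ·rⱼ)/4^K) • (termOp vᵢ)ᴴ * termOp vⱼ`. [cite: Han2020Bootstrap, §2 eq. (2)] -/
theorem termOp_gramTB1 (d : α → ι) (K : ℕ) (RV : List (List ℤ × Terms α)) :
    termOp d (gramTB1 K RV) = ∑ i : Fin RV.length, ∑ j : Fin RV.length,
      ((((idot (RV.get i).1 (RV.get j).1 : ℚ) / 4 ^ K : ℚ)) : ℂ) • ((termOp d (RV.get i).2)ᴴ * termOp d (RV.get j).2) := by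
  rw [gramTB1, termOp_flatMap_get]
  refine Finset.sum_congr rfl fun i _ => ?_
  rw [termOp_flatMap_get]
  refine Finset.sum_congr rfl fun j _ => ?_
  rw [termOp_scaleT, termOp_mulT, termOp_daggerT]

/-- The Gram operators `O ⟨b,i⟩ = termOp d v_{b,i}`. [folklore] -/
noncomputable def gramTBOp (d : α → ι) (blocks : List (List (List ℤ × Terms α))) (x : TBIdx blocks) :
    Matrix (Finset ι) (Finset ι) ℂ :=
  termOp d (tbPoly blocks x)

/-- **The two-level Gram list IS a `gramForm`**: `termOp d (gramTB K blocks) = gramForm (gramTBCoef K blocks) (gramTBOp d blocks)`.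
[cite: Han2020Bootstrap, §2 eq. (2)] [cite: WangEtAl2024, §III] -/
theorem termOp_gramTB_eq_gramForm (d : α → ι) (K : ℕ) (blocks : List (List (List ℤ × Terms α))) :
    termOp d (gramTB K blocks) = gramForm (gramTBCoef K blocks) (gramTBOp d blocks) := by
  rw [gramTB, termOp_flatMap_get, gramForm, Fintype.sum_sigma]
  refine Finset.sum_congr rfl fun b _ => ?_
  rw [termOp_gramTB1]
  refine Finset.sum_congr rfl fun i _ => ?_
  rw [Fintype.sum_sigma, Finset.sum_eq_single b]
  · refine Finset.sum_congr rfl fun j _ => ?_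
    rw [gramTBCoef, Matrix.star_eq_conjTranspose, gramTBOp, gramTBOp, tbPoly, tbPoly, tbRow, tbRow]
    dsimp only
    rw [if_pos rfl]
  · intro b' _ hb'
    refine Finset.sum_eq_zero fun j _ => ?_
    rw [gramTBCoef]
    dsimp only
    rw [if_neg (Ne.symm hb'), zero_smul]
  · intro hb; exact absurd (Finset.mem_univ b) hb

/-- Every factor row is at most `tbCols blocks` long. [folklore] -/
theorem tbRow_length_le (blocks : List (List (List ℤ × Terms α))) (x : TBIdx blocks) :
    (tbRow blocks x).length ≤ tbCols blocks := by
  apply List.le_sum_of_mem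
  refine List.mem_map.2 ⟨(blocks.get x.1).get x.2, ?_, rfl⟩
  exact List.mem_flatMap.2 ⟨blocks.get x.1, List.get_mem blocks x.1, List.get_mem _ x.2⟩

/-- A rational cast is self-adjoint in `ℂ`. [folklore] -/
private theorem star_ratCast (q : ℚ) : star ((q : ℚ) : ℂ) = (q : ℂ) := by
  rw [← Complex.ofReal_ratCast, Complex.star_def, Complex.conj_ofReal]

/-- **`F Fᴴ = Λ`**: the coefficient matrix is the Gram matrix of the zero-padded factor rows. [cite: JanssonChaykinKeil2008, §3] -/
theorem gramTBFactor_mul_conjTranspose (K : ℕ) (blocks : List (List (List ℤ × Terms α))) :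
    gramTBFactor K blocks * (gramTBFactor K blocks)ᴴ = gramTBCoef K blocks := by
  ext x y
  rw [Matrix.mul_apply, Fintype.sum_prod_type, gramTBCoef, Finset.sum_eq_single x.1]
  · by_cases h : x.1 = y.1
    · rw [if_pos h]
      have e : ∀ k : Fin (tbCols blocks),
          gramTBFactor K blocks x (x.1, k) * (gramTBFactor K blocks)ᴴ (x.1, k) y =
            (((((tbRow blocks x).getD k 0 : ℤ) : ℚ) / 2 ^ K * ((((tbRow blocks y).getD k 0 : ℤ) : ℚ) / 2 ^ K) : ℚ) : ℂ) := by
        intro k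
        rw [Matrix.conjTranspose_apply, gramTBFactor, gramTBFactor]
        dsimp only
        rw [if_pos rfl, if_pos h.symm, star_ratCast, ← Rat.cast_mul]
      rw [Finset.sum_congr rfl fun k _ => e k, ← Rat.cast_sum]
      congr 1
      rw [idot_eq_sum_getD _ _ (tbCols blocks) (tbRow_length_le blocks x) (tbRow_length_le blocks y), Int.cast_sum,
        Finset.sum_div]
      refine Finset.sum_congr rfl fun k _ => ?_
      rw [Int.cast_mul, div_mul_div_comm, ← mul_pow, show (2 : ℚ) * 2 = 4 by norm_num]
    · rw [if_neg h]
      refine Finset.sum_eq_zero fun k _ => ?_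
      rw [Matrix.conjTranspose_apply, gramTBFactor, gramTBFactor]
      dsimp only
      rw [if_neg (Ne.symm h), star_zero, mul_zero]
  · intro b _ hb
    refine Finset.sum_eq_zero fun k _ => ?_
    rw [gramTBFactor]
    dsimp only
    rw [if_neg (Ne.symm hb), zero_mul]
  · intro hx; exact absurd (Finset.mem_univ _) hx

/-- **PSD BY CONSTRUCTION**: `gramTBCoef K blocks ⪰ 0` for EVERY block list (no positivity test in a kernel replay).
[cite: JanssonChaykinKeil2008, §3] -/
theorem gramTBCoef_posSemidef (K : ℕ) (blocks : List (List (List ℤ × Terms α))) : (gramTBCoef K blocks).PosSemidef := by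
  rw [← gramTBFactor_mul_conjTranspose]
  exact Matrix.posSemidef_self_mul_conjTranspose _

end Semantics

end CARPolyWindow

end Summit.Ventures.CertifiedManyBodySolver

end
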